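import Literature.MathematicalPhysics.QuantumFieldTheory.Balaban1983to89.Node00.OpsYD2JForm
import Literature.MathematicalPhysics.QuantumFieldTheory.Balaban1983to89.B1Eq324BenfattoClassSectEMemberJRowScaleAtNode00
import HarnessLib

/-!
# `Balaban1983to89.B1Eq324BenfattoClassSectEMemberJRowCompositionAtNode00` — THE PRINT-UNIT `𝒥`-ROW OF THE (3.24) PRECISION DOOR AT A GENERAL
# BACKGROUND, COMPOSED: the kernel of T. Bałaban's Sect. E letter `⟨D̃⁽²⁾·, J⟩(U)` of *Propagators for lattice gauge theories in a background field*,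
# Commun. Math. Phys. **99** (1985) 389–434 [Balaban1985BackgroundPropagators], (3.156) p. 428, at NODE 00's genuine `D2J = d2JOfY` (def-Y
# `Node00.OpsYD2JForm`), from three primitive rows

statement-level companion of published sources with citation tags; every declaration here is a theorem; nothing here is a claim about the
Yang–Mills mass gap

WHY THIS MODULE (cell `pub-ymgap`, seat `dag-n08-d` gen 31, OFFER-87 → CLAIM-89 ∕ INTENT-89, WANTED by seat n08-b g34; node N08 [Balaban1985UV3], the (α)-row
`h324` behind [Balaban1985UV3] (3.24)).  The citable print-unit precision door (n08-b `…PrecisionDoorOnLambda` §3, p676397) displays the `𝒥`-ROW (R2′b) on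
Λ-bonds: `‖((λ_x : ℂ) • (a + ⟨D̃⁽²⁾·,J⟩(U)))(δ_v ⊗ E)(u)‖ ≤ K_J‖E‖e^{−δ|y_u − y_v|}`, `λ_x = ((Lᵏ)⁻¹)^{d+1} = η^{d+1}`.  At `U = 1` it is a theorem
(`…JRowScaleAtNode00.JRowPrint_one_record`, `K_J := θ.b₁`).  At a GENERAL background the `J`-letter is def-Y's GENUINE `D2J(U) = d2JOfY …` of the v8 record
(`sectEYWithDt2_D2J`): `D2J(U)B = 2·ρ_X(B′ ↦ ⟨H₁(U)D̃⁽²⁾(U; B, B′), J(U)⟩_τ)` (p. 428 (3.156), p. 427: *«the function D̃⁽²⁾(B) is a quadratic polynomial in B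
with properties similar to C⁽²⁾(A), only restricted to unit blocks»*, p. 419: *«the function J = D*η⁻²Im ∂U is small, if U satisfies the condition (3.36)»*).
THIS FILE proves the row as a COMPOSITION of three PRIMITIVE DISPLAYED ROWS:
* (i) a PRINT-UNIT COLUMN MASS of `H₁(U)`: `∀ W, λ_x·Σ_{b fine} ‖(H₁(U)W)(b)‖ ≤ M_H·Σ_z ‖W(z)‖` (node N06's content — Thm 3.12, p. 427 *«We have the same
  situation for the operators H₁»*; `λ_x·Σ_fine` is print's `Σ_b η^{d+1}`);
* (ii) LOCALITY and SIZE of the letter `D̃⁽²⁾` ([5]-type, the supplier's): `r₂ < |y_u − y_v| → D̃⁽²⁾(U; δ_v ⊗ E, δ_u ⊗ a) = 0` and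
  `Σ_z ‖D̃⁽²⁾(U; δ_v ⊗ E, δ_u ⊗ a)(z)‖ ≤ C₂‖E‖‖a‖`;
* (iii) a SUP ROW for r06's current: `‖J(U)(b)‖ ≤ j` ((3.117) under (3.36)).
Then, at the fibre of record `M_N(ℂ)` with the `L²`-operator norm:
* §1 fibre bookkeeping (private folklore: `‖M_{pq}‖ ≤ ‖M‖`, `‖tr M‖ ≤ N‖M‖`, `‖E_{pq}(c)‖ ≤ ‖c‖`, `‖M‖ ≤ Σ_{p,q}‖M_{pq}‖`), ★ `norm_rho_trDualMatY_le` (`‖ρ(f)‖ ≤ N²·K` when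
  `‖f(a)‖ ≤ K‖a‖`, def-Y's dualising map `trDualMatY`); §2 the flat trace pairing: `‖⟨Φ, Ψ⟩_tr‖ ≤ N·Σ_b ‖Φ b‖‖Ψ b‖` (`norm_trPairY_le`, `_of_sup`);
* §3 ★★ `mul_norm_d2JOfY_single_le` — for ANY weight `c ≥ 0` carried by row (i): `c·‖D2J(U)(δ_v ⊗ E)(u)‖ ≤ 2N³·j·M_H·C₂·‖E‖` (generic `D̃⁽²⁾`, tables, residual
  letter); ★ `d2JOfY_single_apply_eq_zero` — LOCALITY: `D2J(U)(δ_v ⊗ E)(u) = 0` when `D̃⁽²⁾(U; δ_v ⊗ E, δ_u ⊗ ·) = 0`; ★★ `mul_norm_d2JOfY_single_le_exp` — the two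
  combined into the exponential shape `c·‖D2J(U)(δ_v ⊗ E)(u)‖ ≤ 2N³jM_HC₂·e^{δr₂}·‖E‖·e^{−δ|y_u−y_v|}` for EVERY rate `δ ≥ 0`;
* §4 ★★★ `JRowPrint_sectEYWithDt2` — AT THE v8 LETTERS `sectEYWithDt2 N θ M⋆ 𝔯 𝔡₂ 𝔢₀` (any residual family `𝔯`; at `𝔯 := resYOfC2 N θ M⋆ 𝔠` the v8 instance of
  record): the print-unit `𝒥`-row for ALL `u v E` with `K_J := θ.b₁ + 2N³·j·M_H·C₂·e^{δr₂}` (the `a`-part by `JRowScaleAtNode00` §7), its `0 ≤ K_J` face, and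
  the door's binder order (`JRowPrint_sectEYWithDt2_onΛ`: `∀ u v E, inΛY x u → inΛY x v → …`).

v1.1 (CHECK-K, seat n08-b gen 34 — a located UNIFORMITY defect of row (iii), repaired on PRINT's route): r06's `B9Eq336RegularAtAllBondsP.norm_J_le_of_regYP336`
bounds `‖J_μ(s)‖` by `O(Mα₀)·((L^{lev s}η)³)⁻¹` — LEVEL-dependent, so a member-uniform flat `sup_b ‖J(U)(b)‖ ≤ j` is met only vacuously in the regime (§3–§4
stay correct implications).  NEW §5–§6 re-compose the `J`-part as print does ((3.136) p. 422, p. 427): `H₁` is moved onto the current by def-Y's `τ`-transpose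
(`trPairY_d2JOfY_trAdj`, `trAdjY`), and the row becomes (i†) a PRINT-UNIT SUP OF THE ADJOINT CURRENT `λ_x·‖(H₁(U)†J(U))(z)‖ ≤ j₁` on a FREE support predicate
`S` (the supplier's — e.g. top-level bonds, where print's `O(1)Mα₀(Lᵏη)⁻³ = O(Mα₀)` IS member-uniform) plus (ii-out) the OUTPUT SUPPORT of `D̃⁽²⁾` lies in `S`
([5]: «restricted to unit blocks»); then `K_J := θ.b₁ + 2N³·j₁·C₂·e^{δr₂}` — NO column mass `M_H`, NO flat `j`:
* §5 `norm_trPairY_le_of_sup_on`, `d2JFun_apply_trAdj`, ★★ `mul_norm_d2JOfY_single_le_of_adjCurrent`, ★★ `mul_norm_d2JOfY_single_le_exp_of_adjCurrent`;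
* §6 `KJadj_nonneg`, ★★ `JRowPrint_sectEYWithDt2_of_adjCurrent_at` (one pair of bonds), ★★★ `JRowPrint_sectEYWithDt2_of_adjCurrent` (all bonds),
  ★★★ `JRowPrint_sectEYWithDt2_of_adjCurrent_onΛ` (the door's binder order, (ii-out) on Λ-bonds only), ★★ `…_onΛ'` (all three `D̃⁽²⁾`-rows on Λ-bonds only).

HONEST SCOPE.  Count-neutral finite bookkeeping over def-Y's certified letters (`d2JOfY`, `rieszY`, `trDualMatY`, `trAdjY`, `pairH1JY`, `trPairY`, `H1Y`, `JY`,
`sectEYWithDt2_D2J`, `aY`); rows (i) (ii) (iii) are DISPLAYED — node N06's `H₁` estimate (Thm 3.12), [5]'s letter properties, (3.36)'s smallness of `J` — and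
nothing of [Balaban1985BackgroundPropagators] ∕ [Balaban1985Averaging] ∕ [BenfattoEtAl1978] ∕ [Balaban1985UV3] is asserted; the constants are cruder than
print's; the IDENT is NOT made; `PrintedUV3V` ∕ row `h324c` NOT discharged; node N08 NOT discharged; one finite 𝕋^{d+1} programme — nothing about d = 4
specifically, the continuum, OS axioms, a mass gap or the Clay problem.  No `sorry`, no `def`, no `instance`, no `notation`.
-/

noncomputable section

namespace Literature.MathematicalPhysics.QuantumFieldTheory.Balaban1983to89.B1Eq324BenfattoClassSectEMemberJRowCompositionAtNode00

open scoped Matrix.Norms.L2Operator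
open scoped Matrix
open Literature.MathematicalPhysics.QuantumFieldTheory
open Literature.MathematicalPhysics.QuantumFieldTheory.Balaban1983to89.B9PinMembersKLevelV1 (MemberY)
open Literature.MathematicalPhysics.QuantumFieldTheory.Balaban1983to89.B9PinGeometryKLevelV1 (unitDistY unitDistY_nonneg inΛY)
open Literature.MathematicalPhysics.QuantumFieldTheory.Balaban1983to89.B6KLevelCensusIndexV1 (KIdx)
open Literature.MathematicalPhysics.QuantumFieldTheory.Balaban1983to89.B9Thm314WholePinGeometry (unitDistY_self)
open Literature.MathematicalPhysics.QuantumFieldTheory.Balaban1983to89.B1Eq324BenfattoClassSectEMemberJRowScaleAtNode00 (aY_single_of_ne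
  norm_etaD_smul_aY_single_le inv_pow_pow_pos)
open Literature.MathematicalPhysics.QuantumFieldTheory.Balaban1983to89.Node00

variable {N : ℕ}

/-! ## §1  Fibre bookkeeping: `M_N(ℂ)` under the `L²`-operator norm, and def-Y's dualising map `ρ` -/

section Fibre

/-- an entry is bounded by the `L²`-operator norm (test against a basis vector). [cite: Balaban1985BackgroundPropagators, p.389 (matrix-valued functions), bookkeeping] -/
private theorem norm_entry_le_l2_opNorm (A : Matrix (Fin N) (Fin N) ℂ) (a a' : Fin N) : ‖A a a'‖ ≤ ‖A‖ := by
  have h := Matrix.l2_opNorm_mulVec A (EuclideanSpace.single a' (1 : ℂ))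
  have h1 : ‖(EuclideanSpace.single a' (1 : ℂ))‖ = 1 := by simp
  rw [h1, mul_one] at h
  refine le_trans ?_ h
  refine le_trans (le_of_eq ?_) (PiLp.norm_apply_le _ a)
  simp

/-- **`‖tr M‖ ≤ N·‖M‖`** (`N` diagonal entries, each bounded by the operator norm). [cite: Balaban1985BackgroundPropagators, (3.11) p.392 («tr»), bookkeeping] -/
private theorem norm_trace_le (M : Matrix (Fin N) (Fin N) ℂ) : ‖Matrix.trace M‖ ≤ N * ‖M‖ := by
  rw [Matrix.trace]
  calc ‖∑ i, Matrix.diag M i‖ ≤ ∑ i, ‖Matrix.diag M i‖ := norm_sum_le _ _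
    _ ≤ ∑ _i : Fin N, ‖M‖ := Finset.sum_le_sum fun i _ => norm_entry_le_l2_opNorm M i i
    _ = N * ‖M‖ := by rw [Finset.sum_const, Finset.card_univ, Fintype.card_fin, nsmul_eq_mul]

/-- `‖tr(AB)‖ ≤ N·‖A‖‖B‖`. [cite: Balaban1985BackgroundPropagators, (3.11) p.392, bookkeeping] -/
private theorem norm_trace_mul_le (A B : Matrix (Fin N) (Fin N) ℂ) : ‖Matrix.trace (A * B)‖ ≤ N * (‖A‖ * ‖B‖) :=
  (norm_trace_le _).trans (mul_le_mul_of_nonneg_left (Matrix.l2_opNorm_mul A B) (Nat.cast_nonneg _))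

/-- a matrix unit `E_{pq}(c)` has operator norm `≤ ‖c‖` (it maps `y` to `c·y_q·δ_p`). [cite: Balaban1985BackgroundPropagators, p.389 (matrix units), bookkeeping] -/
private theorem l2_opNorm_single_le (p q : Fin N) (c : ℂ) : ‖Matrix.single p q c‖ ≤ ‖c‖ := by
  set T := Matrix.toEuclideanCLM (n := Fin N) (𝕜 := ℂ) (Matrix.single p q c)
  rw [← Matrix.l2_opNorm_toEuclideanCLM]
  refine T.opNorm_le_bound (norm_nonneg c) fun y => ?_
  have hmv : ∀ w : Fin N → ℂ, Matrix.single p q c *ᵥ w = Pi.single p (c * w q) := by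
    intro w
    funext i
    simp only [Matrix.mulVec, dotProduct, Matrix.single_apply]
    by_cases hi : i = p
    · subst hi
      rw [Pi.single_eq_same, Finset.sum_eq_single q]
      · rw [if_pos ⟨rfl, rfl⟩]
      · intro j _ hj; rw [if_neg (fun h => hj h.2.symm), zero_mul]
      · intro h; exact absurd (Finset.mem_univ _) h
    · rw [Pi.single_eq_of_ne hi]
      exact Finset.sum_eq_zero fun j _ => by rw [if_neg (fun h => hi h.1.symm), zero_mul]
  have hT : T y = EuclideanSpace.single p (c * y q) := by
    apply (WithLp.ofLp_injective (p := 2))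
    rw [Matrix.ofLp_toEuclideanCLM, hmv]
    rfl
  rw [hT]
  calc ‖EuclideanSpace.single p (c * y q)‖ = ‖c * y q‖ := by simp
    _ = ‖c‖ * ‖y q‖ := norm_mul _ _
    _ ≤ ‖c‖ * ‖y‖ := mul_le_mul_of_nonneg_left (PiLp.norm_apply_le y q) (norm_nonneg c)

/-- the operator norm is at most the sum of the entries' moduli (`M = Σ E_{pq}(M_{pq})`). [cite: Balaban1985BackgroundPropagators, p.389, bookkeeping] -/
private theorem l2_opNorm_le_sum_norm_entry (M : Matrix (Fin N) (Fin N) ℂ) : ‖M‖ ≤ ∑ p, ∑ q, ‖M p q‖ := by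
  conv_lhs => rw [Matrix.matrix_eq_sum_single M]
  exact (norm_sum_le _ _).trans (Finset.sum_le_sum fun p _ => (norm_sum_le _ _).trans
    (Finset.sum_le_sum fun q _ => l2_opNorm_single_le p q (M p q)))

/-- ★ **THE DUALISING MAP OF RECORD IS BOUNDED BY `N²`**: `‖ρ(f)‖ ≤ N²·K` whenever `‖f(a)‖ ≤ K‖a‖` (`ρ(f)_{pq} = f(E_{qp})`, def-Y's `trDualMatY_ρ_apply`).
[cite: Balaban1985BackgroundPropagators, (3.134) p.422 (the operator of a quadratic form), p.389; bookkeeping] -/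
theorem norm_rho_trDualMatY_le (f : Matrix (Fin N) (Fin N) ℂ →ₗ[ℂ] ℂ) {K : ℝ} (hf : ∀ a, ‖f a‖ ≤ K * ‖a‖) (hK : 0 ≤ K) :
    ‖(trDualMatY N).ρ f‖ ≤ (N : ℝ) ^ 2 * K := by
  refine (l2_opNorm_le_sum_norm_entry _).trans ?_
  calc ∑ p, ∑ q, ‖(trDualMatY N).ρ f p q‖ ≤ ∑ _p : Fin N, ∑ _q : Fin N, K := by
        refine Finset.sum_le_sum fun p _ => Finset.sum_le_sum fun q _ => ?_
        rw [trDualMatY_ρ_apply]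
        exact (hf _).trans (by nlinarith [l2_opNorm_single_le q p (1 : ℂ), norm_one (α := ℂ), norm_nonneg (Matrix.single q p (1 : ℂ))])
    _ = (N : ℝ) ^ 2 * K := by
        rw [Finset.sum_const, Finset.card_univ, Fintype.card_fin, Finset.sum_const, Finset.card_univ, Fintype.card_fin, smul_smul,
          nsmul_eq_mul, Nat.cast_mul, sq]

end Fibre

/-! ## §2  The flat trace pairing against a sup-bounded current -/

section Pairing

/-- **`‖⟨Φ, Ψ⟩_tr‖ ≤ N·Σ_b ‖Φ(b)‖‖Ψ(b)‖`** for def-Y's flat trace pairing `trPairY` at the trace of record. [cite: Balaban1985BackgroundPropagators, (3.11) p.392 («⟨A, J⟩»), bookkeeping] -/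
theorem norm_trPairY_le {X : Type} [Fintype X] (Φ Ψ : X → Matrix (Fin N) (Fin N) ℂ) :
    ‖trPairY (trDualMatY N).τ Φ Ψ‖ ≤ N * ∑ b, ‖Φ b‖ * ‖Ψ b‖ := by
  rw [trPairY_def, Finset.mul_sum]
  refine (norm_sum_le _ _).trans (Finset.sum_le_sum fun b _ => ?_)
  rw [trDualMatY_τ]
  exact norm_trace_mul_le _ _

/-- ★ against a current with `‖Ψ(b)‖ ≤ j`: `‖⟨Φ, Ψ⟩_tr‖ ≤ N·j·Σ_b ‖Φ(b)‖`. [cite: Balaban1985BackgroundPropagators, (3.11) p.392, (3.117) p.419 («J … is small»), bookkeeping] -/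
theorem norm_trPairY_le_of_sup {X : Type} [Fintype X] (Φ Ψ : X → Matrix (Fin N) (Fin N) ℂ) {j : ℝ}
    (hΨ : ∀ b, ‖Ψ b‖ ≤ j) : ‖trPairY (trDualMatY N).τ Φ Ψ‖ ≤ N * j * ∑ b, ‖Φ b‖ := by
  refine (norm_trPairY_le Φ Ψ).trans ?_
  rw [mul_assoc, Finset.mul_sum (s := Finset.univ) (f := fun b => ‖Φ b‖) j]
  refine mul_le_mul_of_nonneg_left (Finset.sum_le_sum fun b _ => ?_) (Nat.cast_nonneg _)
  rw [mul_comm j]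
  exact mul_le_mul_of_nonneg_left (hΨ b) (norm_nonneg _)

end Pairing

/-! ## §3  The kernel of `D2J(U) = d2JOfY …` on one-bond functions: size from rows (i)–(iii), locality from (ii) -/

section D2J

variable {d ℓ : ℕ} {hd : 1 ≤ d + 1} {hL : Odd (ℓ + 1) ∧ 1 < ℓ + 1} {b₀ b₁ : ℝ}
variable (i : KIdx d ℓ hd hL b₀ b₁) (parS : SiteParY (Matrix (Fin N) (Fin N) ℂ) i) (parB : BondParY (Matrix (Fin N) (Fin N) ℂ) i)
  (Gp : SiteOpY (Matrix (Fin N) (Fin N) ℂ) i) (Δ2 : BondOpY (Matrix (Fin N) (Fin N) ℂ) i)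
  (D : CfgY (Matrix (Fin N) (Fin N) ℂ) i → (IBondY i → Matrix (Fin N) (Fin N) ℂ) →ₗ[ℂ] (IBondY i → Matrix (Fin N) (Fin N) ℂ) →ₗ[ℂ]
    (IBondY i → Matrix (Fin N) (Fin N) ℂ))

/-- def-Y's dualising map on lattice functions at ANY decidable-equality instance of the index (its definition uses the classical one; the instances
agree). [cite: Balaban1985BackgroundPropagators, (3.134) p.422, bookkeeping] -/
theorem rieszY_apply_inst {X : Type} [Fintype X] [DecidableEq X] (F : (X → Matrix (Fin N) (Fin N) ℂ) →ₗ[ℂ] ℂ) (u : X) :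
    rieszY (trDualMatY N) F u = (trDualMatY N).ρ (F ∘ₗ LinearMap.single ℂ (fun _ : X => Matrix (Fin N) (Fin N) ℂ) u) := by
  rw [rieszY_apply]; congr; exact Subsingleton.elim _ _

/-- **`D2J(U)` ON A BOND FUNCTION, AT A BOND**: `(D2J(U)B)(u) = 2·ρ(a ↦ ⟨H₁(U)D̃⁽²⁾(U; B, δ_u ⊗ a), J(U)⟩_tr)` — def-Y's `d2JOfY` unfolded.
[cite: Balaban1985BackgroundPropagators, (3.156) p.428, (3.134) p.422] -/
theorem d2JOfY_apply_apply [DecidableEq (IBondY i)] (U : CfgY (Matrix (Fin N) (Fin N) ℂ) i) (B : IBondY i → Matrix (Fin N) (Fin N) ℂ)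
    (u : IBondY i) :
    d2JOfY (trDualMatY N) i parS parB Gp Δ2 D U B u =
      (2 : ℂ) • (trDualMatY N).ρ ((pairH1JY (trDualMatY N) i parS parB Gp Δ2 U ∘ₗ D U B) ∘ₗ
        LinearMap.single ℂ (fun _ : IBondY i => Matrix (Fin N) (Fin N) ℂ) u) := by
  simp only [d2JOfY, LinearMap.smul_apply, LinearMap.comp_apply, Pi.smul_apply]
  rw [rieszY_apply_inst]
  rfl

/-- the functional read by `ρ`, evaluated: `a ↦ ⟨H₁(U)(D̃⁽²⁾(U; B, δ_u ⊗ a)), J(U)⟩_tr`. [cite: Balaban1985BackgroundPropagators, (3.156) p.428, bookkeeping] -/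
theorem d2JFun_apply [DecidableEq (IBondY i)] (U : CfgY (Matrix (Fin N) (Fin N) ℂ) i) (B : IBondY i → Matrix (Fin N) (Fin N) ℂ)
    (u : IBondY i) (a : Matrix (Fin N) (Fin N) ℂ) :
    ((pairH1JY (trDualMatY N) i parS parB Gp Δ2 U ∘ₗ D U B) ∘ₗ LinearMap.single ℂ (fun _ : IBondY i => Matrix (Fin N) (Fin N) ℂ) u) a =
      trPairY (trDualMatY N).τ (H1Y i parS parB Gp Δ2 U (D U B (Pi.single u a))) (JY i U) := rfl

/-- ★★ **THE SIZE OF THE `D2J` KERNEL FROM ROWS (i)–(iii)**, with an arbitrary weight `c ≥ 0` carried by the column-mass row of `H₁` (flat: `c = 1`; print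
units: `c = λ_x = η^{d+1}`): `c·‖D2J(U)(δ_v ⊗ E)(u)‖ ≤ 2N³·j·m_H·C₂·‖E‖` — `2` from (3.156), `N²` from `ρ`, `N` from `tr`, `j` from `J`, `m_H` from `H₁`'s
column mass, `C₂` from the size of `D̃⁽²⁾(U; δ_v ⊗ E, δ_u ⊗ ·)`. [cite: Balaban1985BackgroundPropagators, (3.156) p.428, (3.129) p.421, (3.117) p.419, Thm 3.12 p.423, p.427; Balaban1985Averaging, (136) p.39] -/
theorem mul_norm_d2JOfY_single_le [DecidableEq (IBondY i)] (U : CfgY (Matrix (Fin N) (Fin N) ℂ) i) {c mH j C₂ : ℝ} (hc : 0 ≤ c)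
    (hmH : 0 ≤ mH) (hj : 0 ≤ j) (hC₂ : 0 ≤ C₂)
    (hH : ∀ W : IBondY i → Matrix (Fin N) (Fin N) ℂ, c * ∑ b, ‖H1Y i parS parB Gp Δ2 U W b‖ ≤ mH * ∑ z, ‖W z‖)
    (hJ : ∀ b, ‖JY i U b‖ ≤ j) (v : IBondY i) (E : Matrix (Fin N) (Fin N) ℂ) (u : IBondY i)
    (hD : ∀ a : Matrix (Fin N) (Fin N) ℂ, ∑ z, ‖D U (Pi.single v E) (Pi.single u a) z‖ ≤ C₂ * ‖E‖ * ‖a‖) :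
    c * ‖d2JOfY (trDualMatY N) i parS parB Gp Δ2 D U (Pi.single v E) u‖ ≤ 2 * (N : ℝ) ^ 3 * j * mH * C₂ * ‖E‖ := by
  have hNj : (0 : ℝ) ≤ N * j := mul_nonneg (Nat.cast_nonneg _) hj
  have hK : (0 : ℝ) ≤ N * j * mH * C₂ * ‖E‖ := mul_nonneg (mul_nonneg (mul_nonneg hNj hmH) hC₂) (norm_nonneg E)
  rw [d2JOfY_apply_apply, norm_smul, Complex.norm_two]
  have hga : ∀ a : Matrix (Fin N) (Fin N) ℂ,
      ‖(((c : ℝ) : ℂ) • ((pairH1JY (trDualMatY N) i parS parB Gp Δ2 U ∘ₗ D U (Pi.single v E)) ∘ₗ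
        LinearMap.single ℂ (fun _ : IBondY i => Matrix (Fin N) (Fin N) ℂ) u)) a‖ ≤ N * j * mH * C₂ * ‖E‖ * ‖a‖ := by
    intro a
    rw [LinearMap.smul_apply, norm_smul, Complex.norm_real, Real.norm_of_nonneg hc, d2JFun_apply]
    calc c * ‖trPairY (trDualMatY N).τ (H1Y i parS parB Gp Δ2 U (D U (Pi.single v E) (Pi.single u a))) (JY i U)‖
        ≤ c * (N * j * ∑ b, ‖H1Y i parS parB Gp Δ2 U (D U (Pi.single v E) (Pi.single u a)) b‖) :=
          mul_le_mul_of_nonneg_left (norm_trPairY_le_of_sup _ _ hJ) hc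
      _ = N * j * (c * ∑ b, ‖H1Y i parS parB Gp Δ2 U (D U (Pi.single v E) (Pi.single u a)) b‖) := by ring
      _ ≤ N * j * (mH * ∑ z, ‖D U (Pi.single v E) (Pi.single u a) z‖) := mul_le_mul_of_nonneg_left (hH _) hNj
      _ ≤ N * j * (mH * (C₂ * ‖E‖ * ‖a‖)) := mul_le_mul_of_nonneg_left (mul_le_mul_of_nonneg_left (hD a) hmH) hNj
      _ = N * j * mH * C₂ * ‖E‖ * ‖a‖ := by ring
  have hρ := norm_rho_trDualMatY_le _ hga hK
  rw [map_smul, norm_smul, Complex.norm_real, Real.norm_of_nonneg hc] at hρ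
  calc c * (2 * ‖(trDualMatY N).ρ ((pairH1JY (trDualMatY N) i parS parB Gp Δ2 U ∘ₗ D U (Pi.single v E)) ∘ₗ
          LinearMap.single ℂ (fun _ : IBondY i => Matrix (Fin N) (Fin N) ℂ) u)‖)
      = 2 * (c * ‖(trDualMatY N).ρ ((pairH1JY (trDualMatY N) i parS parB Gp Δ2 U ∘ₗ D U (Pi.single v E)) ∘ₗ
          LinearMap.single ℂ (fun _ : IBondY i => Matrix (Fin N) (Fin N) ℂ) u)‖) := by ring
    _ ≤ 2 * ((N : ℝ) ^ 2 * (N * j * mH * C₂ * ‖E‖)) := mul_le_mul_of_nonneg_left hρ zero_le_two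
    _ = 2 * (N : ℝ) ^ 3 * j * mH * C₂ * ‖E‖ := by ring

/-- ★ **LOCALITY OF THE `D2J` KERNEL FROM (ii)**: if `D̃⁽²⁾(U; δ_v ⊗ E, δ_u ⊗ a) = 0` for every `a`, then `D2J(U)(δ_v ⊗ E)(u) = 0` — the `J`-term is as
local as the form `D̃⁽²⁾` in its two arguments, whatever `H₁` and `J` are. [cite: Balaban1985BackgroundPropagators, (3.156) p.428, p.427 («restricted to unit blocks»)] -/
theorem d2JOfY_single_apply_eq_zero [DecidableEq (IBondY i)] (U : CfgY (Matrix (Fin N) (Fin N) ℂ) i) (v : IBondY i)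
    (E : Matrix (Fin N) (Fin N) ℂ) (u : IBondY i) (hD : ∀ a : Matrix (Fin N) (Fin N) ℂ, D U (Pi.single v E) (Pi.single u a) = 0) :
    d2JOfY (trDualMatY N) i parS parB Gp Δ2 D U (Pi.single v E) u = 0 := by
  rw [d2JOfY_apply_apply]
  have hg : (pairH1JY (trDualMatY N) i parS parB Gp Δ2 U ∘ₗ D U (Pi.single v E)) ∘ₗ
      LinearMap.single ℂ (fun _ : IBondY i => Matrix (Fin N) (Fin N) ℂ) u = 0 := by
    refine LinearMap.ext fun a => ?_
    rw [d2JFun_apply, hD a, map_zero, trPairY_zero_left, LinearMap.zero_apply]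
  rw [hg, map_zero, smul_zero]

/-- ★★ **SIZE AND LOCALITY IN THE EXPONENTIAL SHAPE**, at a member `x` (the distance `|y − y′|` = def-Y's `unitDistY x`): for EVERY rate `δ ≥ 0`,
`c·‖D2J(U)(δ_v ⊗ E)(u)‖ ≤ 2N³jm_HC₂·e^{δr₂}·‖E‖·e^{−δ|y_u − y_v|}` — beyond `r₂` the left side vanishes, within `r₂` the factor `e^{δ(r₂ − |y_u−y_v|)} ≥ 1` pays
for the decay. [cite: Balaban1985BackgroundPropagators, (3.156) p.428, p.427; BenfattoEtAl1978, Lemma (4.5)–(4.7) p.152 (class form)] -/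
theorem mul_norm_d2JOfY_single_le_exp {Mstar : ℕ} (x : MemberY d ℓ hd hL b₀ b₁ Mstar) [DecidableEq (IBondY x.toKIdx)]
    (parS' : SiteParY (Matrix (Fin N) (Fin N) ℂ) x.toKIdx) (parB' : BondParY (Matrix (Fin N) (Fin N) ℂ) x.toKIdx)
    (Gp' : SiteOpY (Matrix (Fin N) (Fin N) ℂ) x.toKIdx) (Δ2' : BondOpY (Matrix (Fin N) (Fin N) ℂ) x.toKIdx)
    (D' : CfgY (Matrix (Fin N) (Fin N) ℂ) x.toKIdx → (IBondY x.toKIdx → Matrix (Fin N) (Fin N) ℂ) →ₗ[ℂ]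
      (IBondY x.toKIdx → Matrix (Fin N) (Fin N) ℂ) →ₗ[ℂ] (IBondY x.toKIdx → Matrix (Fin N) (Fin N) ℂ))
    (U : CfgY (Matrix (Fin N) (Fin N) ℂ) x.toKIdx) {c mH j C₂ r₂ δ : ℝ} (hc : 0 ≤ c) (hmH : 0 ≤ mH) (hj : 0 ≤ j) (hC₂ : 0 ≤ C₂) (hδ : 0 ≤ δ)
    (hH : ∀ W : IBondY x.toKIdx → Matrix (Fin N) (Fin N) ℂ, c * ∑ b, ‖H1Y x.toKIdx parS' parB' Gp' Δ2' U W b‖ ≤ mH * ∑ z, ‖W z‖)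
    (hJ : ∀ b, ‖JY x.toKIdx U b‖ ≤ j)
    (hDloc : ∀ (u v : IBondY x.toKIdx) (E a : Matrix (Fin N) (Fin N) ℂ), r₂ < unitDistY x u v → D' U (Pi.single v E) (Pi.single u a) = 0)
    (hDsz : ∀ (u v : IBondY x.toKIdx) (E a : Matrix (Fin N) (Fin N) ℂ), ∑ z, ‖D' U (Pi.single v E) (Pi.single u a) z‖ ≤ C₂ * ‖E‖ * ‖a‖)
    (u v : IBondY x.toKIdx) (E : Matrix (Fin N) (Fin N) ℂ) :
    c * ‖d2JOfY (trDualMatY N) x.toKIdx parS' parB' Gp' Δ2' D' U (Pi.single v E) u‖ ≤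
      2 * (N : ℝ) ^ 3 * j * mH * C₂ * Real.exp (δ * r₂) * ‖E‖ * Real.exp (-(δ * unitDistY x u v)) := by
  have hK : (0 : ℝ) ≤ 2 * (N : ℝ) ^ 3 * j * mH * C₂ := by positivity
  by_cases hfar : r₂ < unitDistY x u v
  · rw [d2JOfY_single_apply_eq_zero x.toKIdx parS' parB' Gp' Δ2' D' U v E u (fun a => hDloc u v E a hfar), norm_zero, mul_zero]
    exact mul_nonneg (mul_nonneg (mul_nonneg hK (Real.exp_pos _).le) (norm_nonneg E)) (Real.exp_pos _).le
  · have hnear : unitDistY x u v ≤ r₂ := le_of_not_gt hfar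
    have h1 := mul_norm_d2JOfY_single_le x.toKIdx parS' parB' Gp' Δ2' D' U hc hmH hj hC₂ hH hJ v E u (hDsz u v E)
    have hexp : (1 : ℝ) ≤ Real.exp (δ * r₂) * Real.exp (-(δ * unitDistY x u v)) := by
      rw [← Real.exp_add]
      exact Real.one_le_exp (by nlinarith)
    calc c * ‖d2JOfY (trDualMatY N) x.toKIdx parS' parB' Gp' Δ2' D' U (Pi.single v E) u‖
        ≤ 2 * (N : ℝ) ^ 3 * j * mH * C₂ * ‖E‖ * 1 := by rw [mul_one]; exact h1
      _ ≤ 2 * (N : ℝ) ^ 3 * j * mH * C₂ * ‖E‖ * (Real.exp (δ * r₂) * Real.exp (-(δ * unitDistY x u v))) :=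
          mul_le_mul_of_nonneg_left hexp (mul_nonneg hK (norm_nonneg E))
      _ = 2 * (N : ℝ) ^ 3 * j * mH * C₂ * Real.exp (δ * r₂) * ‖E‖ * Real.exp (-(δ * unitDistY x u v)) := by ring

end D2J

/-! ## §4  AT THE v8 LETTERS OF RECORD `sectEYWithDt2 N θ M⋆ 𝔯 𝔡₂ 𝔢₀`: the print-unit `𝒥`-row at a general background, `K_J := θ.b₁ + 2N³jM_HC₂e^{δr₂}` -/

section Record

variable (θ : Stage3Params) (Mstar' : ℕ) (𝔯 : ResY N θ Mstar') (𝔡₂ : Dt2Y N θ Mstar') (𝔢₀ : SectEY N θ Mstar')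

/-- `0 ≤ K_J` for the composed constant. [cite: Balaban1985BackgroundPropagators, (3.156) p.428, bookkeeping] -/
theorem KJ_nonneg {j MH C₂ r₂ δ : ℝ} (hj : 0 ≤ j) (hMH : 0 ≤ MH) (hC₂ : 0 ≤ C₂) :
    0 ≤ θ.b₁ + 2 * (N : ℝ) ^ 3 * j * MH * C₂ * Real.exp (δ * r₂) :=
  add_nonneg (θ.hb.1.le.trans θ.hb.2) (by positivity)

/-- ★★★ **THE PRINT-UNIT `𝒥`-ROW OF THE PRECISION DOOR AT A GENERAL BACKGROUND, COMPOSED** — at the v8 Sect. E letters `sectEYWithDt2 N θ M⋆ 𝔯 𝔡₂ 𝔢₀`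
(`D2J := d2JOfY` over the record's `H₁ = (lettersYOfRecordV4 N θ M⋆ 𝔯 x).H₁`, def-Y `sectEYWithDt2_D2J` ∕ `covLettersY_v4_H₁`; at `𝔯 := resYOfC2 N θ M⋆ 𝔠`
the v8 instance of record), for EVERY member `x`, background `U`, rate `δ ≥ 0` and ALL bonds `u, v`:
`‖((λ_x : ℂ) • (a + ⟨D̃⁽²⁾·,J⟩(U)))(δ_v ⊗ E)(u)‖ ≤ (θ.b₁ + 2N³·j·M_H·C₂·e^{δr₂})·‖E‖·e^{−δ|y_u − y_v|}`, `λ_x = ((Lᵏ)⁻¹)^{d+1}` (= def-Y `etaDY x`), GIVEN the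
three primitive rows: (i) print-unit column mass of `H₁(U)`, (ii) locality radius `r₂` and size `C₂` of `D̃⁽²⁾(U)` on one-bond arguments, (iii) `‖J(U)(b)‖ ≤ j`.
The `a`-part is seat n08-d's `JRowScaleAtNode00` §7 (`θ.b₁`, `2 ≤ D`); the `J`-part is §3.
[cite: Balaban1985BackgroundPropagators, (3.156) p.428, (3.129) p.421, (3.117) p.419, Thm 3.12 p.423, p.427, (3.26) p.395; Balaban1985Averaging, (136) p.39;
Balaban1984PropagatorsII, (2.16) p.225; BenfattoEtAl1978, Lemma (4.5)–(4.7) p.152 (class form); Balaban1985UV3, (24) p.262] -/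
theorem JRowPrint_sectEYWithDt2 (hD : 2 ≤ θ.d₆ + 1) (x : MemberY θ.d₆ θ.ℓ₆ θ.hd' θ.hL' θ.b₀ θ.b₁ Mstar') [DecidableEq (IBondY x.toKIdx)]
    (U : CfgY (Matrix (Fin N) (Fin N) ℂ) x.toKIdx) {MH j C₂ r₂ δ : ℝ} (hMH : 0 ≤ MH) (hj : 0 ≤ j) (hC₂ : 0 ≤ C₂) (hδ : 0 ≤ δ)
    (hH : ∀ W : IBondY x.toKIdx → Matrix (Fin N) (Fin N) ℂ,
      ((((θ.ℓ₆ + 1 : ℕ) : ℝ)) ^ x.k)⁻¹ ^ (θ.d₆ + 1) * ∑ b, ‖(lettersYOfRecordV4 N θ Mstar' 𝔯 x).H₁ U W b‖ ≤ MH * ∑ z, ‖W z‖)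
    (hJ : ∀ b, ‖JY x.toKIdx U b‖ ≤ j)
    (hDloc : ∀ (u v : IBondY x.toKIdx) (E a : Matrix (Fin N) (Fin N) ℂ), r₂ < unitDistY x u v → (𝔡₂ x).form U (Pi.single v E) (Pi.single u a) = 0)
    (hDsz : ∀ (u v : IBondY x.toKIdx) (E a : Matrix (Fin N) (Fin N) ℂ), ∑ z, ‖(𝔡₂ x).form U (Pi.single v E) (Pi.single u a) z‖ ≤ C₂ * ‖E‖ * ‖a‖)
    (u v : IBondY x.toKIdx) (E : Matrix (Fin N) (Fin N) ℂ) :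
    ‖(((((((θ.ℓ₆ + 1 : ℕ) : ℝ)) ^ x.k)⁻¹ ^ (θ.d₆ + 1) : ℝ) : ℂ) •
        (aY x.toKIdx + (sectEYWithDt2 N θ Mstar' 𝔯 𝔡₂ 𝔢₀ x).D2J U)).restrictScalars ℝ (Pi.single v E) u‖ ≤
      (θ.b₁ + 2 * (N : ℝ) ^ 3 * j * MH * C₂ * Real.exp (δ * r₂)) * ‖E‖ * Real.exp (-(δ * unitDistY x u v)) := by
  have hb₁ : 0 ≤ θ.b₁ := θ.hb.1.le.trans θ.hb.2
  have hlam : (0 : ℝ) ≤ ((((θ.ℓ₆ + 1 : ℕ) : ℝ)) ^ x.k)⁻¹ ^ (θ.d₆ + 1) := (inv_pow_pow_pos x).le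
  rw [LinearMap.restrictScalars_apply, LinearMap.smul_apply, Pi.smul_apply, LinearMap.add_apply, Pi.add_apply, smul_add,
    sectEYWithDt2_D2J]
  refine (norm_add_le _ _).trans ?_
  -- the `a`-part
  have ha : ‖((((((θ.ℓ₆ + 1 : ℕ) : ℝ)) ^ x.k)⁻¹ ^ (θ.d₆ + 1) : ℝ) : ℂ) • aY x.toKIdx (Pi.single v E) u‖ ≤
      θ.b₁ * ‖E‖ * Real.exp (-(δ * unitDistY x u v)) := by
    by_cases huv : u = v
    · subst huv
      rw [unitDistY_self, mul_zero, neg_zero, Real.exp_zero, mul_one]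
      exact norm_etaD_smul_aY_single_le x (by omega) hb₁ u u E
    · rw [aY_single_of_ne _ huv, smul_zero, norm_zero]
      exact mul_nonneg (mul_nonneg hb₁ (norm_nonneg E)) (Real.exp_pos _).le
  -- the `J`-part
  have hJpart : ‖((((((θ.ℓ₆ + 1 : ℕ) : ℝ)) ^ x.k)⁻¹ ^ (θ.d₆ + 1) : ℝ) : ℂ) •
        d2JOfY (trDualMatY N) x.toKIdx (parSymY x.toKIdx) (parBY x.toKIdx) (GpY x.toKIdx (parSymY x.toKIdx)) (𝔯 x).Δ2 (𝔡₂ x).form U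
          (Pi.single v E) u‖ ≤
      2 * (N : ℝ) ^ 3 * j * MH * C₂ * Real.exp (δ * r₂) * ‖E‖ * Real.exp (-(δ * unitDistY x u v)) := by
    rw [norm_smul, Complex.norm_real, Real.norm_of_nonneg hlam]
    exact mul_norm_d2JOfY_single_le_exp x (parSymY x.toKIdx) (parBY x.toKIdx) (GpY x.toKIdx (parSymY x.toKIdx)) (𝔯 x).Δ2 (𝔡₂ x).form U
      hlam hMH hj hC₂ hδ hH hJ hDloc hDsz u v E
  calc ‖((((((θ.ℓ₆ + 1 : ℕ) : ℝ)) ^ x.k)⁻¹ ^ (θ.d₆ + 1) : ℝ) : ℂ) • aY x.toKIdx (Pi.single v E) u‖ +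
        ‖((((((θ.ℓ₆ + 1 : ℕ) : ℝ)) ^ x.k)⁻¹ ^ (θ.d₆ + 1) : ℝ) : ℂ) •
          d2JOfY (trDualMatY N) x.toKIdx (parSymY x.toKIdx) (parBY x.toKIdx) (GpY x.toKIdx (parSymY x.toKIdx)) (𝔯 x).Δ2 (𝔡₂ x).form U
            (Pi.single v E) u‖
      ≤ θ.b₁ * ‖E‖ * Real.exp (-(δ * unitDistY x u v)) +
          2 * (N : ℝ) ^ 3 * j * MH * C₂ * Real.exp (δ * r₂) * ‖E‖ * Real.exp (-(δ * unitDistY x u v)) := add_le_add ha hJpart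
    _ = (θ.b₁ + 2 * (N : ℝ) ^ 3 * j * MH * C₂ * Real.exp (δ * r₂)) * ‖E‖ * Real.exp (-(δ * unitDistY x u v)) := by ring

/-- ★★ **THE DOOR's BINDER ORDER** (seat n08-b's (R2′b)|_Λ, `…PrecisionDoorOnLambda` §3 l.511–513: `∀ u v E, inΛY x u → inΛY x v → …`): the same row,
restricted to Λ-bonds (it holds on all index bonds). [cite: Balaban1985BackgroundPropagators, (3.156) p.428, (3.155) p.427; Balaban1985UV3, (24) p.262] -/
theorem JRowPrint_sectEYWithDt2_onΛ (hD : 2 ≤ θ.d₆ + 1) (x : MemberY θ.d₆ θ.ℓ₆ θ.hd' θ.hL' θ.b₀ θ.b₁ Mstar') [DecidableEq (IBondY x.toKIdx)]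
    (U : CfgY (Matrix (Fin N) (Fin N) ℂ) x.toKIdx) {MH j C₂ r₂ δ : ℝ} (hMH : 0 ≤ MH) (hj : 0 ≤ j) (hC₂ : 0 ≤ C₂) (hδ : 0 ≤ δ)
    (hH : ∀ W : IBondY x.toKIdx → Matrix (Fin N) (Fin N) ℂ,
      ((((θ.ℓ₆ + 1 : ℕ) : ℝ)) ^ x.k)⁻¹ ^ (θ.d₆ + 1) * ∑ b, ‖(lettersYOfRecordV4 N θ Mstar' 𝔯 x).H₁ U W b‖ ≤ MH * ∑ z, ‖W z‖)
    (hJ : ∀ b, ‖JY x.toKIdx U b‖ ≤ j)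
    (hDloc : ∀ (u v : IBondY x.toKIdx) (E a : Matrix (Fin N) (Fin N) ℂ), r₂ < unitDistY x u v → (𝔡₂ x).form U (Pi.single v E) (Pi.single u a) = 0)
    (hDsz : ∀ (u v : IBondY x.toKIdx) (E a : Matrix (Fin N) (Fin N) ℂ), ∑ z, ‖(𝔡₂ x).form U (Pi.single v E) (Pi.single u a) z‖ ≤ C₂ * ‖E‖ * ‖a‖) :
    ∀ (u v : IBondY x.toKIdx) (E : Matrix (Fin N) (Fin N) ℂ), inΛY x u → inΛY x v →
      ‖(((((((θ.ℓ₆ + 1 : ℕ) : ℝ)) ^ x.k)⁻¹ ^ (θ.d₆ + 1) : ℝ) : ℂ) •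
          (aY x.toKIdx + (sectEYWithDt2 N θ Mstar' 𝔯 𝔡₂ 𝔢₀ x).D2J U)).restrictScalars ℝ (Pi.single v E) u‖ ≤
        (θ.b₁ + 2 * (N : ℝ) ^ 3 * j * MH * C₂ * Real.exp (δ * r₂)) * ‖E‖ * Real.exp (-(δ * unitDistY x u v)) :=
  fun u v E _ _ => JRowPrint_sectEYWithDt2 θ Mstar' 𝔯 𝔡₂ 𝔢₀ hD x U hMH hj hC₂ hδ hH hJ hDloc hDsz u v E

end Record

/-! ## §5  (v1.1 — CHECK-K repair (r†)) The kernel of `D2J(U)` from the PRINT-UNIT ADJOINT CURRENT `H₁(U)†J(U)` ON THE OUTPUT SUPPORT OF `D̃⁽²⁾`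

Seat n08-b (gen 34, CHECK-K) located a UNIFORMITY defect of row (iii) above: r06's `B9Eq336RegularAtAllBondsP.norm_J_le_of_regYP336` bounds
`‖J_μ(s)‖` by `10⁴(d+1)·(10L⁴Mα₀)·((L^{lev s}η)³)⁻¹` — LEVEL-dependent (`∝ L^{3k}` at a level-`0` bond) — so a member-uniform flat `sup_b ‖J(U)(b)‖ ≤ j`
(bound before `∀ x` in a family form) is met only vacuously in the regime; §3–§4 stay correct implications.  PRINT's route ((3.136) p. 422, p. 427 *«We
have the same situation for the operators H₁»*) moves `H₁` onto the current: `⟨B′, D2J B⟩_τ = 2⟨D̃⁽²⁾(B, B′), H₁†J⟩_τ` (def-Y `trPairY_d2JOfY_trAdj`,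
the `τ`-transpose `trAdjY`), and bounds `(H₁†J)(z)` only where `D̃⁽²⁾` has output — unit blocks, where print's `|(H₁*J)(z)| ≤ O(1)Mα₀(Lᵏη)⁻³ = O(Mα₀)`
IS member-uniform.  This section re-composes the `J`-part from: (i†) a print-unit sup `c·‖(H₁(U)†J(U))(z)‖ ≤ j₁` on a FREE support predicate
`S : IBondY → Prop` (the supplier's choice — e.g. top-level bonds); (ii-out) the OUTPUT SUPPORT of `D̃⁽²⁾(U; δ_v ⊗ E, δ_u ⊗ a)` lies in `S`; (ii) size
`C₂` and argument-locality `r₂` of `D̃⁽²⁾` as in §3.  NO column mass `M_H`, NO flat `j`: `c·‖D2J(U)(δ_v ⊗ E)(u)‖ ≤ 2N³·j₁·C₂·‖E‖`. -/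

section AdjCurrent

variable {d ℓ : ℕ} {hd : 1 ≤ d + 1} {hL : Odd (ℓ + 1) ∧ 1 < ℓ + 1} {b₀ b₁ : ℝ}
variable (i : KIdx d ℓ hd hL b₀ b₁) (parS : SiteParY (Matrix (Fin N) (Fin N) ℂ) i) (parB : BondParY (Matrix (Fin N) (Fin N) ℂ) i)
  (Gp : SiteOpY (Matrix (Fin N) (Fin N) ℂ) i) (Δ2 : BondOpY (Matrix (Fin N) (Fin N) ℂ) i)
  (D : CfgY (Matrix (Fin N) (Fin N) ℂ) i → (IBondY i → Matrix (Fin N) (Fin N) ℂ) →ₗ[ℂ] (IBondY i → Matrix (Fin N) (Fin N) ℂ) →ₗ[ℂ]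
    (IBondY i → Matrix (Fin N) (Fin N) ℂ))

/-- ★ **THE FLAT TRACE PAIRING AGAINST A CURRENT BOUNDED ONLY ON THE SUPPORT OF THE OTHER FACTOR**, with a weight `c ≥ 0` carried by the current:
if `c·‖Ψ(z)‖ ≤ j₁` wherever `Φ(z) ≠ 0`, then `c·‖⟨Φ, Ψ⟩_tr‖ ≤ N·j₁·Σ_z ‖Φ(z)‖`. [cite: Balaban1985BackgroundPropagators, (3.11) p.392, (3.136) p.422 («(H*J)(b)» bounded on the relevant bonds), bookkeeping] -/
theorem norm_trPairY_le_of_sup_on {X : Type} [Fintype X] (Φ Ψ : X → Matrix (Fin N) (Fin N) ℂ) {c j₁ : ℝ} (hc : 0 ≤ c)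
    (hΨ : ∀ z, Φ z ≠ 0 → c * ‖Ψ z‖ ≤ j₁) : c * ‖trPairY (trDualMatY N).τ Φ Ψ‖ ≤ N * j₁ * ∑ z, ‖Φ z‖ := by
  have hterm : ∀ z, c * (‖Φ z‖ * ‖Ψ z‖) ≤ j₁ * ‖Φ z‖ := by
    intro z
    by_cases hz : Φ z = 0
    · rw [hz, norm_zero, zero_mul, mul_zero, mul_zero]
    · calc c * (‖Φ z‖ * ‖Ψ z‖) = ‖Φ z‖ * (c * ‖Ψ z‖) := by ring
        _ ≤ ‖Φ z‖ * j₁ := mul_le_mul_of_nonneg_left (hΨ z hz) (norm_nonneg _)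
        _ = j₁ * ‖Φ z‖ := mul_comm _ _
  calc c * ‖trPairY (trDualMatY N).τ Φ Ψ‖ ≤ c * (N * ∑ z, ‖Φ z‖ * ‖Ψ z‖) := mul_le_mul_of_nonneg_left (norm_trPairY_le Φ Ψ) hc
    _ = N * ∑ z, c * (‖Φ z‖ * ‖Ψ z‖) := by simp only [Finset.mul_sum]; exact Finset.sum_congr rfl fun z _ => by ring
    _ ≤ N * ∑ z, j₁ * ‖Φ z‖ := mul_le_mul_of_nonneg_left (Finset.sum_le_sum fun z _ => hterm z) (Nat.cast_nonneg _)
    _ = N * j₁ * ∑ z, ‖Φ z‖ := by simp only [Finset.mul_sum]; exact Finset.sum_congr rfl fun z _ => by ring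

/-- ★ **THE FUNCTIONAL READ BY `ρ`, WITH `H₁` MOVED ONTO THE CURRENT**: `a ↦ ⟨D̃⁽²⁾(U; B, δ_u ⊗ a), H₁(U)†J(U)⟩_tr` (def-Y's `τ`-transpose `trAdjY`,
`trPairY_trAdjY`; print's «(H*J)(b)» of (3.136), p. 427 «the same situation for the operators H₁»). [cite: Balaban1985BackgroundPropagators, (3.156) p.428, (3.136) p.422, p.427] -/
theorem d2JFun_apply_trAdj [DecidableEq (IBondY i)] (U : CfgY (Matrix (Fin N) (Fin N) ℂ) i) (B : IBondY i → Matrix (Fin N) (Fin N) ℂ)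
    (u : IBondY i) (a : Matrix (Fin N) (Fin N) ℂ) :
    ((pairH1JY (trDualMatY N) i parS parB Gp Δ2 U ∘ₗ D U B) ∘ₗ LinearMap.single ℂ (fun _ : IBondY i => Matrix (Fin N) (Fin N) ℂ) u) a =
      trPairY (trDualMatY N).τ (D U B (Pi.single u a)) (trAdjY (trDualMatY N) (H1Y i parS parB Gp Δ2 U) (JY i U)) := by
  rw [d2JFun_apply, trPairY_trAdjY]

/-- ★★ **THE SIZE OF THE `D2J` KERNEL FROM THE ADJOINT CURRENT ON THE OUTPUT SUPPORT (rows (i†), (ii-out), (ii))**, with an arbitrary weight `c ≥ 0`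
carried by the adjoint-current row (flat: `c = 1`; print units: `c = λ_x = η^{d+1}`): `c·‖D2J(U)(δ_v ⊗ E)(u)‖ ≤ 2N³·j₁·C₂·‖E‖` — `2` from (3.156), `N²`
from `ρ`, `N` from `tr`, `j₁` from `H₁†J` on `S`, `C₂` from the size of `D̃⁽²⁾(U; δ_v ⊗ E, δ_u ⊗ ·)`; NO column mass of `H₁`, NO flat sup of `J`.
[cite: Balaban1985BackgroundPropagators, (3.156) p.428, (3.136) p.422, (3.129) p.421, (3.117) p.419, p.427; Balaban1985Averaging, (136) p.39] -/
theorem mul_norm_d2JOfY_single_le_of_adjCurrent [DecidableEq (IBondY i)] (U : CfgY (Matrix (Fin N) (Fin N) ℂ) i) (S : IBondY i → Prop)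
    {c j₁ C₂ : ℝ} (hc : 0 ≤ c) (hj₁ : 0 ≤ j₁) (hC₂ : 0 ≤ C₂)
    (hHJ : ∀ z, S z → c * ‖trAdjY (trDualMatY N) (H1Y i parS parB Gp Δ2 U) (JY i U) z‖ ≤ j₁)
    (v : IBondY i) (E : Matrix (Fin N) (Fin N) ℂ) (u : IBondY i)
    (hDsupp : ∀ (a : Matrix (Fin N) (Fin N) ℂ) (z : IBondY i), D U (Pi.single v E) (Pi.single u a) z ≠ 0 → S z)
    (hD : ∀ a : Matrix (Fin N) (Fin N) ℂ, ∑ z, ‖D U (Pi.single v E) (Pi.single u a) z‖ ≤ C₂ * ‖E‖ * ‖a‖) :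
    c * ‖d2JOfY (trDualMatY N) i parS parB Gp Δ2 D U (Pi.single v E) u‖ ≤ 2 * (N : ℝ) ^ 3 * j₁ * C₂ * ‖E‖ := by
  have hNj : (0 : ℝ) ≤ N * j₁ := mul_nonneg (Nat.cast_nonneg _) hj₁
  have hK : (0 : ℝ) ≤ N * j₁ * C₂ * ‖E‖ := mul_nonneg (mul_nonneg hNj hC₂) (norm_nonneg E)
  rw [d2JOfY_apply_apply, norm_smul, Complex.norm_two]
  have hga : ∀ a : Matrix (Fin N) (Fin N) ℂ,
      ‖(((c : ℝ) : ℂ) • ((pairH1JY (trDualMatY N) i parS parB Gp Δ2 U ∘ₗ D U (Pi.single v E)) ∘ₗ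
        LinearMap.single ℂ (fun _ : IBondY i => Matrix (Fin N) (Fin N) ℂ) u)) a‖ ≤ N * j₁ * C₂ * ‖E‖ * ‖a‖ := by
    intro a
    rw [LinearMap.smul_apply, norm_smul, Complex.norm_real, Real.norm_of_nonneg hc, d2JFun_apply_trAdj]
    calc c * ‖trPairY (trDualMatY N).τ (D U (Pi.single v E) (Pi.single u a)) (trAdjY (trDualMatY N) (H1Y i parS parB Gp Δ2 U) (JY i U))‖
        ≤ N * j₁ * ∑ z, ‖D U (Pi.single v E) (Pi.single u a) z‖ :=
          norm_trPairY_le_of_sup_on _ _ hc fun z hz => hHJ z (hDsupp a z hz)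
      _ ≤ N * j₁ * (C₂ * ‖E‖ * ‖a‖) := mul_le_mul_of_nonneg_left (hD a) hNj
      _ = N * j₁ * C₂ * ‖E‖ * ‖a‖ := by ring
  have hρ := norm_rho_trDualMatY_le _ hga hK
  rw [map_smul, norm_smul, Complex.norm_real, Real.norm_of_nonneg hc] at hρ
  calc c * (2 * ‖(trDualMatY N).ρ ((pairH1JY (trDualMatY N) i parS parB Gp Δ2 U ∘ₗ D U (Pi.single v E)) ∘ₗ
          LinearMap.single ℂ (fun _ : IBondY i => Matrix (Fin N) (Fin N) ℂ) u)‖)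
      = 2 * (c * ‖(trDualMatY N).ρ ((pairH1JY (trDualMatY N) i parS parB Gp Δ2 U ∘ₗ D U (Pi.single v E)) ∘ₗ
          LinearMap.single ℂ (fun _ : IBondY i => Matrix (Fin N) (Fin N) ℂ) u)‖) := by ring
    _ ≤ 2 * ((N : ℝ) ^ 2 * (N * j₁ * C₂ * ‖E‖)) := mul_le_mul_of_nonneg_left hρ zero_le_two
    _ = 2 * (N : ℝ) ^ 3 * j₁ * C₂ * ‖E‖ := by ring

/-- ★★ **SIZE AND LOCALITY IN THE EXPONENTIAL SHAPE, FROM THE ADJOINT CURRENT**, at a member `x` (distance `|y − y′|` = def-Y's `unitDistY x`) and a fixed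
pair of bonds `(u, v)`: for EVERY rate `δ ≥ 0`, `c·‖D2J(U)(δ_v ⊗ E)(u)‖ ≤ 2N³j₁C₂·e^{δr₂}·‖E‖·e^{−δ|y_u − y_v|}` — beyond the argument-locality radius `r₂`
the left side vanishes (§3 `d2JOfY_single_apply_eq_zero`), within it `e^{δ(r₂ − |y_u−y_v|)} ≥ 1` pays for the decay.
[cite: Balaban1985BackgroundPropagators, (3.156) p.428, (3.136) p.422, p.427; BenfattoEtAl1978, Lemma (4.5)–(4.7) p.152 (class form)] -/
theorem mul_norm_d2JOfY_single_le_exp_of_adjCurrent {Mstar : ℕ} (x : MemberY d ℓ hd hL b₀ b₁ Mstar) [DecidableEq (IBondY x.toKIdx)]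
    (parS' : SiteParY (Matrix (Fin N) (Fin N) ℂ) x.toKIdx) (parB' : BondParY (Matrix (Fin N) (Fin N) ℂ) x.toKIdx)
    (Gp' : SiteOpY (Matrix (Fin N) (Fin N) ℂ) x.toKIdx) (Δ2' : BondOpY (Matrix (Fin N) (Fin N) ℂ) x.toKIdx)
    (D' : CfgY (Matrix (Fin N) (Fin N) ℂ) x.toKIdx → (IBondY x.toKIdx → Matrix (Fin N) (Fin N) ℂ) →ₗ[ℂ]
      (IBondY x.toKIdx → Matrix (Fin N) (Fin N) ℂ) →ₗ[ℂ] (IBondY x.toKIdx → Matrix (Fin N) (Fin N) ℂ))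
    (U : CfgY (Matrix (Fin N) (Fin N) ℂ) x.toKIdx) (S : IBondY x.toKIdx → Prop) {c j₁ C₂ r₂ δ : ℝ} (hc : 0 ≤ c) (hj₁ : 0 ≤ j₁) (hC₂ : 0 ≤ C₂)
    (hδ : 0 ≤ δ)
    (hHJ : ∀ z, S z → c * ‖trAdjY (trDualMatY N) (H1Y x.toKIdx parS' parB' Gp' Δ2' U) (JY x.toKIdx U) z‖ ≤ j₁)
    (u v : IBondY x.toKIdx) (E : Matrix (Fin N) (Fin N) ℂ)
    (hDsupp : ∀ (a : Matrix (Fin N) (Fin N) ℂ) (z : IBondY x.toKIdx), D' U (Pi.single v E) (Pi.single u a) z ≠ 0 → S z)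
    (hDloc : ∀ a : Matrix (Fin N) (Fin N) ℂ, r₂ < unitDistY x u v → D' U (Pi.single v E) (Pi.single u a) = 0)
    (hDsz : ∀ a : Matrix (Fin N) (Fin N) ℂ, ∑ z, ‖D' U (Pi.single v E) (Pi.single u a) z‖ ≤ C₂ * ‖E‖ * ‖a‖) :
    c * ‖d2JOfY (trDualMatY N) x.toKIdx parS' parB' Gp' Δ2' D' U (Pi.single v E) u‖ ≤
      2 * (N : ℝ) ^ 3 * j₁ * C₂ * Real.exp (δ * r₂) * ‖E‖ * Real.exp (-(δ * unitDistY x u v)) := by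
  have hK : (0 : ℝ) ≤ 2 * (N : ℝ) ^ 3 * j₁ * C₂ := by positivity
  by_cases hfar : r₂ < unitDistY x u v
  · rw [d2JOfY_single_apply_eq_zero x.toKIdx parS' parB' Gp' Δ2' D' U v E u (fun a => hDloc a hfar), norm_zero, mul_zero]
    exact mul_nonneg (mul_nonneg (mul_nonneg hK (Real.exp_pos _).le) (norm_nonneg E)) (Real.exp_pos _).le
  · have hnear : unitDistY x u v ≤ r₂ := le_of_not_gt hfar
    have h1 := mul_norm_d2JOfY_single_le_of_adjCurrent x.toKIdx parS' parB' Gp' Δ2' D' U S hc hj₁ hC₂ hHJ v E u hDsupp hDsz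
    have hexp : (1 : ℝ) ≤ Real.exp (δ * r₂) * Real.exp (-(δ * unitDistY x u v)) := by
      rw [← Real.exp_add]
      exact Real.one_le_exp (by nlinarith)
    calc c * ‖d2JOfY (trDualMatY N) x.toKIdx parS' parB' Gp' Δ2' D' U (Pi.single v E) u‖
        ≤ 2 * (N : ℝ) ^ 3 * j₁ * C₂ * ‖E‖ * 1 := by rw [mul_one]; exact h1
      _ ≤ 2 * (N : ℝ) ^ 3 * j₁ * C₂ * ‖E‖ * (Real.exp (δ * r₂) * Real.exp (-(δ * unitDistY x u v))) :=
          mul_le_mul_of_nonneg_left hexp (mul_nonneg hK (norm_nonneg E))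
      _ = 2 * (N : ℝ) ^ 3 * j₁ * C₂ * Real.exp (δ * r₂) * ‖E‖ * Real.exp (-(δ * unitDistY x u v)) := by ring

end AdjCurrent

/-! ## §6  (v1.1) AT THE v8 LETTERS OF RECORD: the print-unit `𝒥`-row from the adjoint current, `K_J := θ.b₁ + 2N³j₁C₂e^{δr₂}` -/

section RecordAdj

variable (θ : Stage3Params) (Mstar' : ℕ) (𝔯 : ResY N θ Mstar') (𝔡₂ : Dt2Y N θ Mstar') (𝔢₀ : SectEY N θ Mstar')

/-- `0 ≤ K_J` for the adjoint-current constant. [cite: Balaban1985BackgroundPropagators, (3.156) p.428, bookkeeping] -/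
theorem KJadj_nonneg {j₁ C₂ r₂ δ : ℝ} (hj₁ : 0 ≤ j₁) (hC₂ : 0 ≤ C₂) :
    0 ≤ θ.b₁ + 2 * (N : ℝ) ^ 3 * j₁ * C₂ * Real.exp (δ * r₂) :=
  add_nonneg (θ.hb.1.le.trans θ.hb.2) (by positivity)

/-- ★★ **THE PRINT-UNIT `𝒥`-ROW FROM THE ADJOINT CURRENT, AT ONE PAIR OF BONDS `(u, v)`** — at the v8 Sect. E letters `sectEYWithDt2 N θ M⋆ 𝔯 𝔡₂ 𝔢₀`
(`D2J := d2JOfY` over the record's `H₁ = (lettersYOfRecordV4 N θ M⋆ 𝔯 x).H₁`, def-Y `sectEYWithDt2_D2J` ∕ `covLettersY_v4_H₁`), with the three `D̃⁽²⁾`-rows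
asked only at this pair: `‖((λ_x : ℂ) • (a + ⟨D̃⁽²⁾·,J⟩(U)))(δ_v ⊗ E)(u)‖ ≤ (θ.b₁ + 2N³·j₁·C₂·e^{δr₂})·‖E‖·e^{−δ|y_u − y_v|}`, `λ_x = ((Lᵏ)⁻¹)^{d+1}` (= def-Y
`etaDY x`).  The `a`-part is `JRowScaleAtNode00` §7 (`θ.b₁`, `2 ≤ D`); the `J`-part is §5.
[cite: Balaban1985BackgroundPropagators, (3.156) p.428, (3.136) p.422, (3.129) p.421, (3.117) p.419, p.427, (3.26) p.395; Balaban1985Averaging, (136) p.39;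
Balaban1984PropagatorsII, (2.14) p.225; BenfattoEtAl1978, Lemma (4.5)–(4.7) p.152 (class form); Balaban1985UV3, (24) p.262] -/
theorem JRowPrint_sectEYWithDt2_of_adjCurrent_at (hD : 2 ≤ θ.d₆ + 1) (x : MemberY θ.d₆ θ.ℓ₆ θ.hd' θ.hL' θ.b₀ θ.b₁ Mstar')
    [DecidableEq (IBondY x.toKIdx)] (U : CfgY (Matrix (Fin N) (Fin N) ℂ) x.toKIdx) (S : IBondY x.toKIdx → Prop) {j₁ C₂ r₂ δ : ℝ}
    (hj₁ : 0 ≤ j₁) (hC₂ : 0 ≤ C₂) (hδ : 0 ≤ δ)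
    (hHJ : ∀ z, S z → ((((θ.ℓ₆ + 1 : ℕ) : ℝ)) ^ x.k)⁻¹ ^ (θ.d₆ + 1) *
      ‖trAdjY (trDualMatY N) ((lettersYOfRecordV4 N θ Mstar' 𝔯 x).H₁ U) (JY x.toKIdx U) z‖ ≤ j₁)
    (u v : IBondY x.toKIdx) (E : Matrix (Fin N) (Fin N) ℂ)
    (hDsupp : ∀ (a : Matrix (Fin N) (Fin N) ℂ) (z : IBondY x.toKIdx), (𝔡₂ x).form U (Pi.single v E) (Pi.single u a) z ≠ 0 → S z)
    (hDloc : ∀ a : Matrix (Fin N) (Fin N) ℂ, r₂ < unitDistY x u v → (𝔡₂ x).form U (Pi.single v E) (Pi.single u a) = 0)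
    (hDsz : ∀ a : Matrix (Fin N) (Fin N) ℂ, ∑ z, ‖(𝔡₂ x).form U (Pi.single v E) (Pi.single u a) z‖ ≤ C₂ * ‖E‖ * ‖a‖) :
    ‖(((((((θ.ℓ₆ + 1 : ℕ) : ℝ)) ^ x.k)⁻¹ ^ (θ.d₆ + 1) : ℝ) : ℂ) •
        (aY x.toKIdx + (sectEYWithDt2 N θ Mstar' 𝔯 𝔡₂ 𝔢₀ x).D2J U)).restrictScalars ℝ (Pi.single v E) u‖ ≤
      (θ.b₁ + 2 * (N : ℝ) ^ 3 * j₁ * C₂ * Real.exp (δ * r₂)) * ‖E‖ * Real.exp (-(δ * unitDistY x u v)) := by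
  have hb₁ : 0 ≤ θ.b₁ := θ.hb.1.le.trans θ.hb.2
  have hlam : (0 : ℝ) ≤ ((((θ.ℓ₆ + 1 : ℕ) : ℝ)) ^ x.k)⁻¹ ^ (θ.d₆ + 1) := (inv_pow_pow_pos x).le
  rw [LinearMap.restrictScalars_apply, LinearMap.smul_apply, Pi.smul_apply, LinearMap.add_apply, Pi.add_apply, smul_add,
    sectEYWithDt2_D2J]
  refine (norm_add_le _ _).trans ?_
  -- the `a`-part
  have ha : ‖((((((θ.ℓ₆ + 1 : ℕ) : ℝ)) ^ x.k)⁻¹ ^ (θ.d₆ + 1) : ℝ) : ℂ) • aY x.toKIdx (Pi.single v E) u‖ ≤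
      θ.b₁ * ‖E‖ * Real.exp (-(δ * unitDistY x u v)) := by
    by_cases huv : u = v
    · subst huv
      rw [unitDistY_self, mul_zero, neg_zero, Real.exp_zero, mul_one]
      exact norm_etaD_smul_aY_single_le x (by omega) hb₁ u u E
    · rw [aY_single_of_ne _ huv, smul_zero, norm_zero]
      exact mul_nonneg (mul_nonneg hb₁ (norm_nonneg E)) (Real.exp_pos _).le
  -- the `J`-part, from the adjoint current
  have hJpart : ‖((((((θ.ℓ₆ + 1 : ℕ) : ℝ)) ^ x.k)⁻¹ ^ (θ.d₆ + 1) : ℝ) : ℂ) •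
        d2JOfY (trDualMatY N) x.toKIdx (parSymY x.toKIdx) (parBY x.toKIdx) (GpY x.toKIdx (parSymY x.toKIdx)) (𝔯 x).Δ2 (𝔡₂ x).form U
          (Pi.single v E) u‖ ≤
      2 * (N : ℝ) ^ 3 * j₁ * C₂ * Real.exp (δ * r₂) * ‖E‖ * Real.exp (-(δ * unitDistY x u v)) := by
    rw [norm_smul, Complex.norm_real, Real.norm_of_nonneg hlam]
    exact mul_norm_d2JOfY_single_le_exp_of_adjCurrent x (parSymY x.toKIdx) (parBY x.toKIdx) (GpY x.toKIdx (parSymY x.toKIdx)) (𝔯 x).Δ2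
      (𝔡₂ x).form U S hlam hj₁ hC₂ hδ hHJ u v E hDsupp hDloc hDsz
  calc ‖((((((θ.ℓ₆ + 1 : ℕ) : ℝ)) ^ x.k)⁻¹ ^ (θ.d₆ + 1) : ℝ) : ℂ) • aY x.toKIdx (Pi.single v E) u‖ +
        ‖((((((θ.ℓ₆ + 1 : ℕ) : ℝ)) ^ x.k)⁻¹ ^ (θ.d₆ + 1) : ℝ) : ℂ) •
          d2JOfY (trDualMatY N) x.toKIdx (parSymY x.toKIdx) (parBY x.toKIdx) (GpY x.toKIdx (parSymY x.toKIdx)) (𝔯 x).Δ2 (𝔡₂ x).form U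
            (Pi.single v E) u‖
      ≤ θ.b₁ * ‖E‖ * Real.exp (-(δ * unitDistY x u v)) +
          2 * (N : ℝ) ^ 3 * j₁ * C₂ * Real.exp (δ * r₂) * ‖E‖ * Real.exp (-(δ * unitDistY x u v)) := add_le_add ha hJpart
    _ = (θ.b₁ + 2 * (N : ℝ) ^ 3 * j₁ * C₂ * Real.exp (δ * r₂)) * ‖E‖ * Real.exp (-(δ * unitDistY x u v)) := by ring

/-- ★★★ **THE PRINT-UNIT `𝒥`-ROW OF THE PRECISION DOOR AT A GENERAL BACKGROUND, FROM THE ADJOINT CURRENT** — for EVERY member `x`, background `U`,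
rate `δ ≥ 0` and ALL bonds `u, v`: `‖((λ_x : ℂ) • (a + ⟨D̃⁽²⁾·,J⟩(U)))(δ_v ⊗ E)(u)‖ ≤ (θ.b₁ + 2N³·j₁·C₂·e^{δr₂})·‖E‖·e^{−δ|y_u − y_v|}`, GIVEN:
(i†) the PRINT-UNIT SUP OF THE ADJOINT CURRENT on a support predicate `S` of the supplier's choice, `S z → λ_x·‖(H₁(U)†J(U))(z)‖ ≤ j₁` (node N06's content:
(3.136) for `H₁` at the top level, p. 427, member-uniform `O(Mα₀)` there under (3.36)); (ii-out) the OUTPUT SUPPORT of `D̃⁽²⁾(U; δ_v ⊗ E, δ_u ⊗ a)` lies in `S`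
([5]: «restricted to unit blocks»); (ii) argument-locality `r₂` and size `C₂` of `D̃⁽²⁾` VERBATIM as §4's binders.  Supersedes §4's row set (i)(iii) for
consumers in the regime (CHECK-K); NO column mass `M_H`, NO flat sup `j`.
[cite: Balaban1985BackgroundPropagators, (3.156) p.428, (3.136) p.422, (3.129) p.421, (3.117) p.419, p.427; Balaban1985Averaging, (136) p.39;
Balaban1984PropagatorsII, (2.14) p.225; BenfattoEtAl1978, Lemma (4.5)–(4.7) p.152 (class form); Balaban1985UV3, (24) p.262] -/
theorem JRowPrint_sectEYWithDt2_of_adjCurrent (hD : 2 ≤ θ.d₆ + 1) (x : MemberY θ.d₆ θ.ℓ₆ θ.hd' θ.hL' θ.b₀ θ.b₁ Mstar')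
    [DecidableEq (IBondY x.toKIdx)] (U : CfgY (Matrix (Fin N) (Fin N) ℂ) x.toKIdx) (S : IBondY x.toKIdx → Prop) {j₁ C₂ r₂ δ : ℝ}
    (hj₁ : 0 ≤ j₁) (hC₂ : 0 ≤ C₂) (hδ : 0 ≤ δ)
    (hHJ : ∀ z, S z → ((((θ.ℓ₆ + 1 : ℕ) : ℝ)) ^ x.k)⁻¹ ^ (θ.d₆ + 1) *
      ‖trAdjY (trDualMatY N) ((lettersYOfRecordV4 N θ Mstar' 𝔯 x).H₁ U) (JY x.toKIdx U) z‖ ≤ j₁)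
    (hDsupp : ∀ (u v : IBondY x.toKIdx) (E a : Matrix (Fin N) (Fin N) ℂ) (z : IBondY x.toKIdx),
      (𝔡₂ x).form U (Pi.single v E) (Pi.single u a) z ≠ 0 → S z)
    (hDloc : ∀ (u v : IBondY x.toKIdx) (E a : Matrix (Fin N) (Fin N) ℂ), r₂ < unitDistY x u v → (𝔡₂ x).form U (Pi.single v E) (Pi.single u a) = 0)
    (hDsz : ∀ (u v : IBondY x.toKIdx) (E a : Matrix (Fin N) (Fin N) ℂ), ∑ z, ‖(𝔡₂ x).form U (Pi.single v E) (Pi.single u a) z‖ ≤ C₂ * ‖E‖ * ‖a‖)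
    (u v : IBondY x.toKIdx) (E : Matrix (Fin N) (Fin N) ℂ) :
    ‖(((((((θ.ℓ₆ + 1 : ℕ) : ℝ)) ^ x.k)⁻¹ ^ (θ.d₆ + 1) : ℝ) : ℂ) •
        (aY x.toKIdx + (sectEYWithDt2 N θ Mstar' 𝔯 𝔡₂ 𝔢₀ x).D2J U)).restrictScalars ℝ (Pi.single v E) u‖ ≤
      (θ.b₁ + 2 * (N : ℝ) ^ 3 * j₁ * C₂ * Real.exp (δ * r₂)) * ‖E‖ * Real.exp (-(δ * unitDistY x u v)) :=
  JRowPrint_sectEYWithDt2_of_adjCurrent_at θ Mstar' 𝔯 𝔡₂ 𝔢₀ hD x U S hj₁ hC₂ hδ hHJ u v E (hDsupp u v E) (hDloc u v E) (hDsz u v E)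

/-- ★★★ **THE DOOR's BINDER ORDER, WITH THE OUTPUT-SUPPORT ROW ON Λ-BONDS ONLY** (seat n08-b's (R2′b)|_Λ, `…PrecisionDoorOnLambda` §3 ∕
`…PrecisionDoorRowsByName` §4: `∀ u v E, inΛY x u → inΛY x v → …`): the same row restricted to Λ-bonds, where row (ii-out) is asked ONLY for Λ-bond arguments
(`inΛY x u → inΛY x v → D̃⁽²⁾(U; δ_v ⊗ E, δ_u ⊗ a)(z) ≠ 0 → S z`) — the shape in which [5]'s «restricted to unit blocks» supplies it — and rows (ii) as §4's.
[cite: Balaban1985BackgroundPropagators, (3.156) p.428, (3.155) p.427, (3.136) p.422; Balaban1985UV3, (24) p.262] -/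
theorem JRowPrint_sectEYWithDt2_of_adjCurrent_onΛ (hD : 2 ≤ θ.d₆ + 1) (x : MemberY θ.d₆ θ.ℓ₆ θ.hd' θ.hL' θ.b₀ θ.b₁ Mstar')
    [DecidableEq (IBondY x.toKIdx)] (U : CfgY (Matrix (Fin N) (Fin N) ℂ) x.toKIdx) (S : IBondY x.toKIdx → Prop) {j₁ C₂ r₂ δ : ℝ}
    (hj₁ : 0 ≤ j₁) (hC₂ : 0 ≤ C₂) (hδ : 0 ≤ δ)
    (hHJ : ∀ z, S z → ((((θ.ℓ₆ + 1 : ℕ) : ℝ)) ^ x.k)⁻¹ ^ (θ.d₆ + 1) *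
      ‖trAdjY (trDualMatY N) ((lettersYOfRecordV4 N θ Mstar' 𝔯 x).H₁ U) (JY x.toKIdx U) z‖ ≤ j₁)
    (hDsupp : ∀ (u v : IBondY x.toKIdx) (E a : Matrix (Fin N) (Fin N) ℂ) (z : IBondY x.toKIdx), inΛY x u → inΛY x v →
      (𝔡₂ x).form U (Pi.single v E) (Pi.single u a) z ≠ 0 → S z)
    (hDloc : ∀ (u v : IBondY x.toKIdx) (E a : Matrix (Fin N) (Fin N) ℂ), r₂ < unitDistY x u v → (𝔡₂ x).form U (Pi.single v E) (Pi.single u a) = 0)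
    (hDsz : ∀ (u v : IBondY x.toKIdx) (E a : Matrix (Fin N) (Fin N) ℂ), ∑ z, ‖(𝔡₂ x).form U (Pi.single v E) (Pi.single u a) z‖ ≤ C₂ * ‖E‖ * ‖a‖) :
    ∀ (u v : IBondY x.toKIdx) (E : Matrix (Fin N) (Fin N) ℂ), inΛY x u → inΛY x v →
      ‖(((((((θ.ℓ₆ + 1 : ℕ) : ℝ)) ^ x.k)⁻¹ ^ (θ.d₆ + 1) : ℝ) : ℂ) •
          (aY x.toKIdx + (sectEYWithDt2 N θ Mstar' 𝔯 𝔡₂ 𝔢₀ x).D2J U)).restrictScalars ℝ (Pi.single v E) u‖ ≤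
        (θ.b₁ + 2 * (N : ℝ) ^ 3 * j₁ * C₂ * Real.exp (δ * r₂)) * ‖E‖ * Real.exp (-(δ * unitDistY x u v)) :=
  fun u v E hu hv => JRowPrint_sectEYWithDt2_of_adjCurrent_at θ Mstar' 𝔯 𝔡₂ 𝔢₀ hD x U S hj₁ hC₂ hδ hHJ u v E
    (fun a z h => hDsupp u v E a z hu hv h) (hDloc u v E) (hDsz u v E)

/-- ★★ **ALL THREE `D̃⁽²⁾`-ROWS ON Λ-BONDS ONLY** — the door's binder order with rows (ii-out), (ii)-locality and (ii)-size each asked only for Λ-bond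
arguments (the weakest supplier-side shape at the door's granularity). [cite: Balaban1985BackgroundPropagators, (3.156) p.428, (3.155) p.427; Balaban1985UV3, (24) p.262] -/
theorem JRowPrint_sectEYWithDt2_of_adjCurrent_onΛ' (hD : 2 ≤ θ.d₆ + 1) (x : MemberY θ.d₆ θ.ℓ₆ θ.hd' θ.hL' θ.b₀ θ.b₁ Mstar')
    [DecidableEq (IBondY x.toKIdx)] (U : CfgY (Matrix (Fin N) (Fin N) ℂ) x.toKIdx) (S : IBondY x.toKIdx → Prop) {j₁ C₂ r₂ δ : ℝ}
    (hj₁ : 0 ≤ j₁) (hC₂ : 0 ≤ C₂) (hδ : 0 ≤ δ)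
    (hHJ : ∀ z, S z → ((((θ.ℓ₆ + 1 : ℕ) : ℝ)) ^ x.k)⁻¹ ^ (θ.d₆ + 1) *
      ‖trAdjY (trDualMatY N) ((lettersYOfRecordV4 N θ Mstar' 𝔯 x).H₁ U) (JY x.toKIdx U) z‖ ≤ j₁)
    (hDsupp : ∀ (u v : IBondY x.toKIdx) (E a : Matrix (Fin N) (Fin N) ℂ) (z : IBondY x.toKIdx), inΛY x u → inΛY x v →
      (𝔡₂ x).form U (Pi.single v E) (Pi.single u a) z ≠ 0 → S z)
    (hDloc : ∀ (u v : IBondY x.toKIdx) (E a : Matrix (Fin N) (Fin N) ℂ), inΛY x u → inΛY x v → r₂ < unitDistY x u v →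
      (𝔡₂ x).form U (Pi.single v E) (Pi.single u a) = 0)
    (hDsz : ∀ (u v : IBondY x.toKIdx) (E a : Matrix (Fin N) (Fin N) ℂ), inΛY x u → inΛY x v →
      ∑ z, ‖(𝔡₂ x).form U (Pi.single v E) (Pi.single u a) z‖ ≤ C₂ * ‖E‖ * ‖a‖) :
    ∀ (u v : IBondY x.toKIdx) (E : Matrix (Fin N) (Fin N) ℂ), inΛY x u → inΛY x v →
      ‖(((((((θ.ℓ₆ + 1 : ℕ) : ℝ)) ^ x.k)⁻¹ ^ (θ.d₆ + 1) : ℝ) : ℂ) •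
          (aY x.toKIdx + (sectEYWithDt2 N θ Mstar' 𝔯 𝔡₂ 𝔢₀ x).D2J U)).restrictScalars ℝ (Pi.single v E) u‖ ≤
        (θ.b₁ + 2 * (N : ℝ) ^ 3 * j₁ * C₂ * Real.exp (δ * r₂)) * ‖E‖ * Real.exp (-(δ * unitDistY x u v)) :=
  fun u v E hu hv => JRowPrint_sectEYWithDt2_of_adjCurrent_at θ Mstar' 𝔯 𝔡₂ 𝔢₀ hD x U S hj₁ hC₂ hδ hHJ u v E
    (fun a z h => hDsupp u v E a z hu hv h) (fun a h => hDloc u v E a hu hv h) (fun a => hDsz u v E a hu hv)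

end RecordAdj

end Literature.MathematicalPhysics.QuantumFieldTheory.Balaban1983to89.B1Eq324BenfattoClassSectEMemberJRowCompositionAtNode00
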